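import Summits.NavierStokesRegularity.FluidComputer.PalasekTowerShadowRegistration

/-!
# THE SHADOW LEMMA, LITE LETTER: the far field is needed only DURING THE CROSSING, and the readout faces
# may sit anywhere in the schedule ball

Cell `ns-blowup`, seat `ns-blowup-ecbridge-3` (g10; D-0074 GROUP C «BRIDGE SUPPORT», lineage
`host_preparation`; bears_on LADDER-NS N1, route `PalasekTowerBreakdown` rev 19, crux `EpisodeBaseT` =
item stmt-NavierStokesRegularity-20303, crux-strategist line «robustmirror», stub T2 `ShadowRegistersT` — landed
as `Shadow.registration_open` / `palasekTowerBreakdown_shadowRegistersT`). LABEL: E–C typing + kernel analysis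
(theorems only; no definition, no named fact, no `sorry`). WHAT THIS IS NOT: not Navier–Stokes evidence — no free
run with (lite) slack faces is exhibited; the theorem says what ONE such run would give. Nothing about `RungG 1` or
blow-up.

## Why a lite letter (diagnose, then vary — tranche-0 rows of 2026-08-27, STATUS l.10027 / l.10069, MODEL)

The proof of the shadow lemma (`PalasekTowerShadowRegistration.lean`) reads the letter `SlackFaces` of the line
«robustmirror» ONLY as follows: the far-field clause F2 (speed `≤ Y₀ − η` outside the ball `r₁` on the WHOLE slab)
is used solely to anchor the perturbed run outside `r₁` at times `t < τ₀′ ≤ τ₀ + σ`, and before `τ₀ − η` the early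
anchor F0 already does it everywhere — so F2 is needed only on the CROSSING WINDOW `[τ₀ − η, τ₀ + η]`; and the
level-`0`/level-`1` strain, core and speed faces (F3, F6, F7) are read at points that only have to lie in the
SCHEDULE ball `‖x‖ ≤ r`, not in the small hitting ball `r₁`. The tranche-0 sterile rows (tower-B t0D S10n/S9n, MODEL)
miss F2 exactly because the structure drifts outward AFTER the crossing (core radius `25 → 128 > r₁ = 75` from
`t ≈ 314 > τ₀ ≈ 218`). This file proves the shadow lemma from the LITE letter:

* F2″ : `∀ t ∈ [τ₀ − η, τ₀ + η], ∀ x, r₁ < ‖x‖ → ‖u t x‖ ≤ Y₀ − η` (far field during the crossing only);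
* F3′, F6a′, F6b′, F7a′, F7b′ : the same faces with `‖x‖ ≤ r` (the schedule radius) in place of `‖x‖ ≤ r₁`;
* no hypothesis `η < w₀`;
everything else (F0, F1a, F1b with `r₁`, F4, F5, classical finite-energy free run on `[0, τ₀ + w₀ + η]`) verbatim.

`Shadow.registration_open_lite` — registration is C⁰-OPEN at the datum among data confined to `B̄(0, r)`;
`Shadow.episodeBaseGAt_of_slackFacesLite` — `EpisodeBaseGAt R` from ONE free run with the lite faces. The strong
letter implies the lite one (restrict F2; `r₁ ≤ r`), so `Shadow.registration_open` is also a corollary of this file.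

References: S. Palasek, arXiv:2605.13827 §3.3, §4 [cite: Palasek2026ElementaryModel, §3.3]; T. Tao,
Anal. PDE 6 (2013) Thm. 5.4 [cite: Tao2011, Thm. 5.4 (ii)+(iv)]; G. Koch, N. Nadirashvili, G. Seregin,
V. Šverák, Acta Math. 203 (2009) §4 (4.10) [cite: KochNadirashviliSereginSverak2009, §4 (4.10)].
-/

noncomputable section

namespace Summit.NavierStokesRegularity.FluidComputer.PalasekTowerClayBridge

open Set MeasureTheory Filter Topology Function
open scoped ENNReal NNReal ContDiff
open Literature.Analysis Literature.Analysis.FluidPDE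

namespace Shadow

section Main

variable {R : TowerRates} {c₃ q : ℝ}
  {u : ℝ → EuclideanSpace ℝ (Fin 3) → EuclideanSpace ℝ (Fin 3)} {p : ℝ → EuclideanSpace ℝ (Fin 3) → ℝ}
  {τ₀ η r r₁ : ℝ}

/-- **THE SHADOW (RE-TIMING) LEMMA at the rates `R`, LITE LETTER.** As `Shadow.registration_open`, but the
far-field clause is asked only on the crossing window `[τ₀ − η, τ₀ + η]` (F2″), the readout faces F3/F6/F7 are
localised in the schedule ball `‖x‖ ≤ r` instead of the hitting ball `r₁`, and `η < w₀` is not assumed: there is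
`ε > 0` such that every smooth divergence-free rapidly decaying datum `a` confined to `B̄(0, r)` with `‖a − u 0‖ ≤ ε`
everywhere is the datum of a pinned (`8`, `6/5`) rigid quiet UNFORCED schedule of radius `r` on `R` with a
`Margins.routeG` stage at level `1`. [cite: Palasek2026ElementaryModel, §3.3] [cite: Tao2011, Thm. 5.4 (ii)+(iv)]
[cite: KochNadirashviliSereginSverak2009, §4 (4.10)] -/
theorem registration_open_lite (hR : R.BoxNumerics c₃ q) (hr₁r : r₁ ≤ r)
    (hη : 0 < η) (hητ : η < τ₀)
    (hcl : IsClassicalNSSolutionOn (Icc 0 (τ₀ + R.window 0 + η)) 1 0 u p)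
    (hE : ∃ C : ℝ≥0∞, C < ⊤ ∧ ∀ t ∈ Icc 0 (τ₀ + R.window 0 + η), ∫⁻ x, ‖u t x‖ₑ ^ 2 ≤ C)
    (hF0 : ∀ t ∈ Icc 0 (τ₀ - η), ∀ x, ‖u t x‖ ≤ R.Y 0 - η)
    (hF1a : ∀ t ∈ Icc (τ₀ - η) τ₀, ∀ x, ‖u t x‖ ≤ R.Y 0 - η * (τ₀ - t))
    (hF1b : ∀ t ∈ Icc τ₀ (τ₀ + η), ∃ x, ‖x‖ ≤ r₁ ∧ R.Y 0 + η * (t - τ₀) ≤ ‖u t x‖)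
    (hF2 : ∀ t ∈ Icc (τ₀ - η) (τ₀ + η), ∀ x, r₁ < ‖x‖ → ‖u t x‖ ≤ R.Y 0 - η)
    (hF3 : ∀ t ∈ Icc (τ₀ + R.window 0 - η) (τ₀ + R.window 0 + η),
      ∃ x, ‖x‖ ≤ r ∧ R.Y 1 + η ≤ ‖u t x‖)
    (hF4 : ∀ t ∈ Icc 0 (τ₀ + R.window 0 + η), ∀ x, ‖u t x‖ ≤ 5 / 3 * R.Y 1 - η)
    (hF5 : ∀ t ∈ Icc 0 (τ₀ + η), ∀ x, ‖u t x‖ ≤ 5 / 3 * R.Y 0 - η)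
    (hF6a : ∀ t ∈ Icc (τ₀ - η) (τ₀ + η), ∃ x, ‖x‖ ≤ r ∧ R.A 0 + η ≤ ‖fderiv ℝ (u t) x‖)
    (hF6b : ∀ t ∈ Icc (τ₀ + R.window 0 - η) (τ₀ + R.window 0 + η),
      ∃ x, ‖x‖ ≤ r ∧ R.A 1 + η ≤ ‖fderiv ℝ (u t) x‖)
    (hF7a : ∀ t ∈ Icc (τ₀ - η) (τ₀ + η), ∃ (x : EuclideanSpace ℝ (Fin 3)) (γ : ℝ → EuclideanSpace ℝ (Fin 3)),
      ‖x‖ ≤ r ∧ ContDiff ℝ 1 γ ∧ γ 0 = γ 1 ∧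
      (∀ s ∈ Icc (0 : ℝ) 1, γ s ∈ Metric.closedBall x (1 / R.N 0)) ∧
      (∀ s ∈ Icc (0 : ℝ) 1, ‖deriv γ s‖ ≤ 8 * Real.pi / R.N 0) ∧
      R.N 0 ^ (R.β - 2) + η ≤ circulation (u t) γ)
    (hF7b : ∀ t ∈ Icc (τ₀ + R.window 0 - η) (τ₀ + R.window 0 + η),
      ∃ (x : EuclideanSpace ℝ (Fin 3)) (γ : ℝ → EuclideanSpace ℝ (Fin 3)),
      ‖x‖ ≤ r ∧ ContDiff ℝ 1 γ ∧ γ 0 = γ 1 ∧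
      (∀ s ∈ Icc (0 : ℝ) 1, γ s ∈ Metric.closedBall x (1 / R.N 1)) ∧
      (∀ s ∈ Icc (0 : ℝ) 1, ‖deriv γ s‖ ≤ 8 * Real.pi / R.N 1) ∧
      R.N 1 ^ (R.β - 2) + η ≤ circulation (u t) γ) :
    ∃ ε : ℝ, 0 < ε ∧
      ∀ a : EuclideanSpace ℝ (Fin 3) → EuclideanSpace ℝ (Fin 3),
        ContDiff ℝ ∞ a → VectorCalculus.IsDivFree a → HasRapidSpatialDecay a →
        (∀ x, r < ‖x‖ → a x = 0) → (∀ x, ‖a x - u 0 x‖ ≤ ε) →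
        ∃ S' : Schedule R,
          S'.u₀ = a ∧ S'.f = 0 ∧ S'.radius = r ∧ S'.Pins 8 (6 / 5) ∧ S'.Rigid ∧ S'.Quiet ∧
          Nonempty (Stage 1 R S' (Margins.routeG R) 1) := by
  -- ### constants
  set w₀ : ℝ := R.window 0 with hw₀_def
  have hw₀ : 0 < w₀ := R.window_pos 0
  set T : ℝ := τ₀ + w₀ + η with hT_def
  have hτ₀ : 0 < τ₀ := hη.trans hητ
  have hT : 0 < T := by positivity
  have hY0 : 0 < R.Y 0 := Real.rpow_pos_of_pos (R.N_pos 0) _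
  have hY1 : 0 < R.Y 1 := Real.rpow_pos_of_pos (R.N_pos 1) _
  set M : ℝ := 5 / 3 * R.Y 1 with hM_def
  have hM : 0 < M := by positivity
  have hbd : ∀ t ∈ Icc 0 T, ∀ x, ‖u t x‖ ≤ M := fun t ht x => (hF4 t ht x).trans (by linarith)
  set δ₀ : ℝ := (τ₀ - η) / 2 with hδ₀_def
  have hδ₀ : 0 < δ₀ := by rw [hδ₀_def]; linarith
  set θ : ℝ := η * min 1 η / 32 with hθ_def
  have hmin : 0 < min 1 η := lt_min one_pos hη
  have hθ : 0 < θ := by positivity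
  have hθη32 : θ ≤ η / 32 := by
    have h1 : η * min 1 η ≤ η * 1 := mul_le_mul_of_nonneg_left (min_le_left _ _) hη.le
    rw [hθ_def]; linarith
  have hθηη : θ ≤ η * η / 32 := by
    have h1 : η * min 1 η ≤ η * η := mul_le_mul_of_nonneg_left (min_le_right _ _) hη.le
    rw [hθ_def]; linarith
  have hθη : θ < η := by linarith
  set σ : ℝ := θ / η with hσ_def
  have hσ : 0 < σ := by positivity
  have hησ : η * σ = θ := by rw [hσ_def]; field_simp
  have hση32 : σ ≤ η / 32 := by
    rw [hσ_def, div_le_div_iff₀ hη (by norm_num : (0 : ℝ) < 32)]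
    nlinarith
  have hση : σ < η := by linarith
  have h8πθ : 8 * Real.pi * θ ≤ η := by
    have := Real.pi_le_four
    nlinarith
  -- ### the C¹ shadow
  obtain ⟨ε, hε, hshadow⟩ := FreeRun.exists_C1_shadow hT hcl hE hM hbd hδ₀ hθ
  refine ⟨ε, hε, fun a ha hadiv hadec haconf haε => ?_⟩
  obtain ⟨v, qv, hv, hv0, hEv, hC0, hC1⟩ := hshadow a ha hadiv hadec haε
  have hup : ∀ t ∈ Icc 0 T, ∀ x, ‖v t x‖ ≤ ‖u t x‖ + θ := by
    intro t ht x
    have h1 := norm_sub_norm_le (v t x) (u t x)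
    linarith [hC0 t ht x]
  have hlo : ∀ t ∈ Icc 0 T, ∀ x, ‖u t x‖ - θ ≤ ‖v t x‖ := by
    intro t ht x
    have h1 := norm_sub_norm_le (u t x) (v t x)
    rw [norm_sub_rev] at h1
    linarith [hC0 t ht x]
  have hloD : ∀ t ∈ Ioo δ₀ T, ∀ x, ‖fderiv ℝ (u t) x‖ - θ ≤ ‖fderiv ℝ (v t) x‖ := by
    intro t ht x
    have h1 := norm_sub_norm_le (fderiv ℝ (u t) x) (fderiv ℝ (v t) x)
    rw [norm_sub_rev] at h1
    linarith [hC1 t ht x]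
  have hcontv : ContinuousOn (uncurry v) (Icc 0 T ×ˢ univ) :=
    (show ContDiffOn ℝ ∞ (uncurry v) (Icc 0 T ×ˢ univ) from hv.smooth_velocity).continuousOn
  -- ### the first hitting time `τ₀'` of the level-0 floor inside `‖x‖ ≤ r₁`
  have htstar : τ₀ + σ ∈ Icc 0 T := ⟨by linarith, by rw [hT_def]; linarith⟩
  have hhit : ∃ t ∈ Icc 0 T, ∃ x : EuclideanSpace ℝ (Fin 3), ‖x‖ ≤ r₁ ∧ R.Y 0 ≤ ‖v t x‖ := by
    obtain ⟨x, hx, hfl⟩ := hF1b (τ₀ + σ) ⟨by linarith, by linarith⟩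
    refine ⟨τ₀ + σ, htstar, x, hx, ?_⟩
    have h1 := hlo (τ₀ + σ) htstar x
    have h2 : η * (τ₀ + σ - τ₀) = θ := by rw [add_sub_cancel_left, hησ]
    rw [h2] at hfl
    linarith
  obtain ⟨τ₀', ⟨hτ₀'T, x₀, hx₀, hfl₀⟩, hleast⟩ := exists_isLeast_floorTime hcontv hhit
  have hτ₀'le : τ₀' ≤ τ₀ + σ := by
    obtain ⟨x, hx, hfl⟩ := hF1b (τ₀ + σ) ⟨by linarith, by linarith⟩
    refine hleast ⟨htstar, x, hx, ?_⟩
    have h1 := hlo (τ₀ + σ) htstar x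
    have h2 : η * (τ₀ + σ - τ₀) = θ := by rw [add_sub_cancel_left, hησ]
    rw [h2] at hfl
    linarith
  have hτ₀'ge : τ₀ - σ ≤ τ₀' := by
    by_contra hlt
    push Not at hlt
    have h1 := hup τ₀' hτ₀'T x₀
    rcases le_or_gt τ₀' (τ₀ - η) with hle | hgt
    · have h2 := hF0 τ₀' ⟨hτ₀'T.1, hle⟩ x₀
      linarith
    · have h2 := hF1a τ₀' ⟨hgt.le, by linarith⟩ x₀
      have h3 : η * σ < η * (τ₀ - τ₀') := mul_lt_mul_of_pos_left (by linarith) hη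
      rw [hησ] at h3
      linarith
  have hτ₀'pos : 0 < τ₀' := by linarith
  have hδτ₀' : δ₀ < τ₀' := by rw [hδ₀_def]; linarith
  have hτ₀'ltT : τ₀' < T := by rw [hT_def]; linarith
  -- the global anchor before `τ₀'`
  have hanchor : ∀ t ∈ Ico 0 τ₀', ∀ x, ‖v t x‖ < R.Y 0 := by
    intro t ht x
    have htT : t ∈ Icc 0 T := ⟨ht.1, (ht.2.le.trans hτ₀'T.2)⟩
    by_cases hx : ‖x‖ ≤ r₁
    · by_contra hge
      push Not at hge
      have := hleast ⟨htT, x, hx, hge⟩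
      linarith [ht.2]
    · push Not at hx
      have h2 := hup t htT x
      rcases le_or_gt t (τ₀ - η) with hle | hgt
      · have h1 := hF0 t ⟨ht.1, hle⟩ x
        linarith
      · have h1 := hF2 t ⟨hgt.le, by linarith [ht.2]⟩ x hx
        linarith
  -- ### the re-timed schedule
  set τ₁' : ℝ := τ₀' + w₀ with hτ₁'_def
  have hτ₁'pos : 0 < τ₁' := by positivity
  have hτ₁'ltT : τ₁' < T := by rw [hτ₁'_def, hT_def]; linarith
  have hτ₁'win : τ₁' ∈ Icc (τ₀ + R.window 0 - η) (τ₀ + R.window 0 + η) :=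
    ⟨by rw [hτ₁'_def]; linarith, by rw [hτ₁'_def]; linarith⟩
  have hδτ₁' : δ₀ < τ₁' := by linarith
  have hτ₀'win : τ₀' ∈ Icc (τ₀ - η) (τ₀ + η) := ⟨by linarith, by linarith⟩
  obtain ⟨S', hS'u₀, hS'f, hS'τ0, hS'τ1, hS'rad, hS'c₁, hS'c₂, hS'qt, hrigid, hquiet, hpins⟩ :
      ∃ S' : Schedule R, S'.u₀ = a ∧ S'.f = 0 ∧ S'.τ 0 = τ₀' ∧ S'.τ 1 = τ₁' ∧ S'.radius = r ∧
        S'.c₁ = 1 ∧ S'.c₂ = 5 / 3 ∧ S'.τ 1 - S'.c₅ * Real.log (R.N 1) / R.A 0 = τ₀' ∧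
        S'.Rigid ∧ S'.Quiet ∧ S'.Pins 8 (6 / 5) :=
    ⟨Schedule.ofWindowsFrom R c₃ q hR.r_nonneg hR.r_lt_one hR.geo hR.clock (hR.sep 0) τ₀' hτ₀'pos a
        hadec r,
      rfl, rfl, Schedule.ofWindowsFrom_τ_zero _ _ _ _ _ hτ₀'pos hadec,
      Schedule.ofWindowsFrom_τ_one _ _ _ _ _ hτ₀'pos hadec, rfl, rfl, rfl,
      Schedule.ofWindowsFrom_τ_one_sub_window _ _ _ _ _ hτ₀'pos hadec,
      Schedule.ofWindowsFrom_rigid _ _ _ _ _ hτ₀'pos hadec, Schedule.ofWindowsFrom_quiet _ _ _ _ _ hτ₀'pos hadec,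
      Schedule.ofWindowsFrom_pins _ _ _ _ _ hτ₀'pos hadec hR.sep haconf 8⟩
  refine ⟨S', hS'u₀, hS'f, hS'rad, hpins, hrigid, hquiet, ⟨?_⟩⟩
  -- ### the stage at level 1
  have hsub1 : Icc 0 τ₁' ⊆ Icc 0 T := Icc_subset_Icc le_rfl hτ₁'ltT.le
  have hτ₀'I : τ₀' ∈ Ioo δ₀ T := ⟨hδτ₀', hτ₀'ltT⟩
  have hτ₁'I : τ₁' ∈ Ioo δ₀ T := ⟨hδτ₁', hτ₁'ltT⟩
  have hτ₁'T : τ₁' ∈ Icc 0 T := ⟨hτ₁'pos.le, hτ₁'ltT.le⟩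
  have hcontu : ∀ t ∈ Icc 0 T, Continuous (u t) := fun t ht => (hcl.contDiff_velocity ht).continuous
  have hcontv' : ∀ t ∈ Icc 0 T, Continuous (v t) := fun t ht => (hv.contDiff_velocity ht).continuous
  -- core loops read through the perturbation
  have hcore : ∀ (j : ℕ) (t : ℝ), t ∈ Icc 0 T →
      (∃ (x : EuclideanSpace ℝ (Fin 3)) (γ : ℝ → EuclideanSpace ℝ (Fin 3)),
        ‖x‖ ≤ r ∧ ContDiff ℝ 1 γ ∧ γ 0 = γ 1 ∧
        (∀ s ∈ Icc (0 : ℝ) 1, γ s ∈ Metric.closedBall x (1 / R.N j)) ∧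
        (∀ s ∈ Icc (0 : ℝ) 1, ‖deriv γ s‖ ≤ 8 * Real.pi / R.N j) ∧
        R.N j ^ (R.β - 2) + η ≤ circulation (u t) γ) →
      ∃ (x : EuclideanSpace ℝ (Fin 3)) (γ : ℝ → EuclideanSpace ℝ (Fin 3)),
        ‖x‖ ≤ S'.radius ∧ ContDiff ℝ 1 γ ∧ γ 0 = γ 1 ∧
        (∀ s ∈ Icc (0 : ℝ) 1, γ s ∈ Metric.closedBall x (1 / R.N j)) ∧
        (∀ s ∈ Icc (0 : ℝ) 1, ‖deriv γ s‖ ≤ 8 * Real.pi / R.N j) ∧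
        S'.c₁ * R.N j ^ (R.β - 2) ≤ circulation (v t) γ := by
    rintro j t ht ⟨x, γ, hx, hγ, hγ0, hball, hspeed, hcirc⟩
    refine ⟨x, γ, by rw [hS'rad]; exact hx, hγ, hγ0, hball, hspeed, ?_⟩
    rw [hS'c₁, one_mul]
    have hL : θ * (8 * Real.pi / R.N j) ≤ η := by
      have h1 : 8 * Real.pi / R.N j ≤ 8 * Real.pi :=
        div_le_self (by positivity) (R.one_lt_N j).le
      have h2 : θ * (8 * Real.pi / R.N j) ≤ θ * (8 * Real.pi) := mul_le_mul_of_nonneg_left h1 hθ.le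
      linarith
    exact circulation_ge_of_near (hcontu t ht) (hcontv' t ht) hγ (fun y => hC0 t ht y) hspeed hL hcirc
  exact
    { u := v
      p := qv
      classical := by
        rw [hS'τ1, hS'f]
        exact hv.mono hsub1 (uniqueDiffOn_Icc hτ₁'pos)
      initial := by rw [hS'u₀]; exact hv0
      energy := by
        obtain ⟨C, hC, hb⟩ := hEv
        refine ⟨C, hC, fun t ht => hb t ?_⟩
        rw [hS'τ1] at ht
        exact hsub1 ht
      floor := by
        intro j hj
        rcases Nat.le_one_iff_eq_zero_or_eq_one.1 hj with rfl | rfl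
        · refine ⟨x₀, by rw [hS'rad]; exact hx₀.trans hr₁r, ?_⟩
          rw [hS'c₁, hS'τ0, one_mul]
          exact hfl₀
        · obtain ⟨x, hx, hfl⟩ := hF3 τ₁' hτ₁'win
          refine ⟨x, by rw [hS'rad]; exact hx, ?_⟩
          rw [hS'c₁, hS'τ1, one_mul]
          have h1 := hlo τ₁' hτ₁'T x
          linarith
      ceiling := by
        intro j hj t ht x
        rcases Nat.le_one_iff_eq_zero_or_eq_one.1 hj with rfl | rfl
        · rw [hS'τ0] at ht
          have htT : t ∈ Icc 0 T := ⟨ht.1, ht.2.trans hτ₀'T.2⟩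
          have h1 := hF5 t ⟨ht.1, by linarith [ht.2]⟩ x
          have h2 := hup t htT x
          rw [hS'c₂]
          linarith
        · rw [hS'τ1] at ht
          have htT : t ∈ Icc 0 T := hsub1 ht
          have h1 := hF4 t htT x
          have h2 := hup t htT x
          rw [hS'c₂]
          linarith
      quiet := by
        intro j hj t ht x
        obtain rfl : j = 0 := by omega
        simp only [Nat.zero_add] at ht
        rw [hS'qt] at ht
        have htT : t ∈ Icc 0 T := ⟨ht.1, ht.2.trans hτ₀'T.2⟩
        have h1 := hF5 t ⟨ht.1, by linarith [ht.2]⟩ x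
        have h2 := hup t htT x
        rw [hS'c₂]
        linarith
      margin := by
        refine ⟨?_, ?_, hrigid, ?_⟩
        · -- strain floors at both readouts
          intro j hj
          rcases Nat.le_one_iff_eq_zero_or_eq_one.1 hj with rfl | rfl
          · obtain ⟨x, hx, hfl⟩ := hF6a τ₀' hτ₀'win
            refine ⟨x, by rw [hS'rad]; exact hx, ?_⟩
            rw [hS'c₁, hS'τ0, one_mul]
            have h1 := hloD τ₀' hτ₀'I x
            linarith
          · obtain ⟨x, hx, hfl⟩ := hF6b τ₁' hτ₁'win
            refine ⟨x, by rw [hS'rad]; exact hx, ?_⟩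
            rw [hS'c₁, hS'τ1, one_mul]
            have h1 := hloD τ₁' hτ₁'I x
            linarith
        · -- the GLOBAL level-0 anchor
          intro t ht x
          rw [hS'c₁, one_mul]
          rw [hS'τ0] at ht
          exact hanchor t ht x
        · -- the core ledger at both readouts
          intro j hj
          rcases Nat.le_one_iff_eq_zero_or_eq_one.1 hj with rfl | rfl
          · rw [hS'τ0]
            exact hcore 0 τ₀' hτ₀'T (hF7a τ₀' hτ₀'win)
          · rw [hS'τ1]
            exact hcore 1 τ₁' hτ₁'T (hF7b τ₁' hτ₁'win) }

/-- **`EpisodeBaseGAt R` FROM ONE FREE RUN WITH THE LITE SLACK FACES (no force anywhere, no symmetry).**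
If a classical finite-energy FREE run `(u, p)` on `[0, τ₀ + w₀ + η]` from a datum confined to `B̄(0, r)` shows
the lite faces (F0, F1 and the crossing-window far field F2″ about the hitting ball `r₁ ≤ r`; F3–F7 in the
schedule ball `r`), then the rates `R` carry a pinned rigid quiet schedule with a `Margins.routeG` stage at level
`1`: the lite shadow lemma applied to the datum itself. [cite: Palasek2026ElementaryModel, §3.3] [cite: Tao2011, Thm. 5.4 (ii)+(iv)] -/
theorem episodeBaseGAt_of_slackFacesLite (hR : R.BoxNumerics c₃ q) (hr₁r : r₁ ≤ r)
    (hη : 0 < η) (hητ : η < τ₀)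
    (hcl : IsClassicalNSSolutionOn (Icc 0 (τ₀ + R.window 0 + η)) 1 0 u p)
    (hconf : ∀ x, r < ‖x‖ → u 0 x = 0)
    (hE : ∃ C : ℝ≥0∞, C < ⊤ ∧ ∀ t ∈ Icc 0 (τ₀ + R.window 0 + η), ∫⁻ x, ‖u t x‖ₑ ^ 2 ≤ C)
    (hF0 : ∀ t ∈ Icc 0 (τ₀ - η), ∀ x, ‖u t x‖ ≤ R.Y 0 - η)
    (hF1a : ∀ t ∈ Icc (τ₀ - η) τ₀, ∀ x, ‖u t x‖ ≤ R.Y 0 - η * (τ₀ - t))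
    (hF1b : ∀ t ∈ Icc τ₀ (τ₀ + η), ∃ x, ‖x‖ ≤ r₁ ∧ R.Y 0 + η * (t - τ₀) ≤ ‖u t x‖)
    (hF2 : ∀ t ∈ Icc (τ₀ - η) (τ₀ + η), ∀ x, r₁ < ‖x‖ → ‖u t x‖ ≤ R.Y 0 - η)
    (hF3 : ∀ t ∈ Icc (τ₀ + R.window 0 - η) (τ₀ + R.window 0 + η),
      ∃ x, ‖x‖ ≤ r ∧ R.Y 1 + η ≤ ‖u t x‖)
    (hF4 : ∀ t ∈ Icc 0 (τ₀ + R.window 0 + η), ∀ x, ‖u t x‖ ≤ 5 / 3 * R.Y 1 - η)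
    (hF5 : ∀ t ∈ Icc 0 (τ₀ + η), ∀ x, ‖u t x‖ ≤ 5 / 3 * R.Y 0 - η)
    (hF6a : ∀ t ∈ Icc (τ₀ - η) (τ₀ + η), ∃ x, ‖x‖ ≤ r ∧ R.A 0 + η ≤ ‖fderiv ℝ (u t) x‖)
    (hF6b : ∀ t ∈ Icc (τ₀ + R.window 0 - η) (τ₀ + R.window 0 + η),
      ∃ x, ‖x‖ ≤ r ∧ R.A 1 + η ≤ ‖fderiv ℝ (u t) x‖)
    (hF7a : ∀ t ∈ Icc (τ₀ - η) (τ₀ + η), ∃ (x : EuclideanSpace ℝ (Fin 3)) (γ : ℝ → EuclideanSpace ℝ (Fin 3)),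
      ‖x‖ ≤ r ∧ ContDiff ℝ 1 γ ∧ γ 0 = γ 1 ∧
      (∀ s ∈ Icc (0 : ℝ) 1, γ s ∈ Metric.closedBall x (1 / R.N 0)) ∧
      (∀ s ∈ Icc (0 : ℝ) 1, ‖deriv γ s‖ ≤ 8 * Real.pi / R.N 0) ∧
      R.N 0 ^ (R.β - 2) + η ≤ circulation (u t) γ)
    (hF7b : ∀ t ∈ Icc (τ₀ + R.window 0 - η) (τ₀ + R.window 0 + η),
      ∃ (x : EuclideanSpace ℝ (Fin 3)) (γ : ℝ → EuclideanSpace ℝ (Fin 3)),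
      ‖x‖ ≤ r ∧ ContDiff ℝ 1 γ ∧ γ 0 = γ 1 ∧
      (∀ s ∈ Icc (0 : ℝ) 1, γ s ∈ Metric.closedBall x (1 / R.N 1)) ∧
      (∀ s ∈ Icc (0 : ℝ) 1, ‖deriv γ s‖ ≤ 8 * Real.pi / R.N 1) ∧
      R.N 1 ^ (R.β - 2) + η ≤ circulation (u t) γ) :
    EpisodeBaseGAt R := by
  obtain ⟨ε, hε, hopen⟩ := registration_open_lite hR hr₁r hη hητ hcl hE hF0 hF1a hF1b hF2 hF3 hF4 hF5
    hF6a hF6b hF7a hF7b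
  have hτ₀ : 0 < τ₀ := hη.trans hητ
  have h0 : (0 : ℝ) ∈ Icc 0 (τ₀ + R.window 0 + η) := by
    refine ⟨le_rfl, ?_⟩
    have := R.window_pos 0
    linarith
  have hsm : ContDiff ℝ ∞ (u 0) := hcl.contDiff_velocity h0
  have hsupp : HasCompactSupport (u 0) := by
    refine HasCompactSupport.of_support_subset_isCompact
      (isCompact_closedBall (0 : EuclideanSpace ℝ (Fin 3)) r) fun x hx => ?_
    rw [Metric.mem_closedBall, dist_zero_right]
    by_contra h
    exact hx (hconf x (lt_of_not_ge h))
  obtain ⟨S', -, -, -, hP, hRg, hQ, hs⟩ := hopen (u 0) hsm (hcl.divFree 0 h0)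
    (HasRapidSpatialDecay.of_hasCompactSupport hsm hsupp) hconf (fun x => by simp [hε.le])
  exact ⟨S', hP, hRg, hQ, hs⟩

end Main

end Shadow

end Summit.NavierStokesRegularity.FluidComputer.PalasekTowerClayBridge

end
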